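import Summits.BirchSwinnertonDyer.BirchSwinnertonDyer.Theorems.PrintCFramBottomClassIndexLawFiveLeThetaQExpansion
import Summits.BirchSwinnertonDyer.BirchSwinnertonDyer.Theorems.PrintCFramBottomClassIndexLawFiveLeFlipRungTransport
import Literature.NumberTheory.EllipticCurves.HalfIntegralWeightClassProjection
import Literature.NumberTheory.EllipticCurves.TunnellFormsAutomorphy
import HarnessLib

/-!
# Crux `PrintCFram.BottomClassIndexLawFiveLe` (stmt-BirchSwinnertonDyer-20372), line `eisenstein-resource-bdp-line` (registry v29 `stub_flipRungs.2`):
# THE 2-ADIC FLIPPED-CUSP RUNG, modular assembly piece (A1) — THE KATZ VEHICLE `V = P·θ` AS A `Γ₁`-MODULAR FORM AND ITS INPUT SIDE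
# (cell `bsd-print-cfram`, width seat `bsd-line-cfram-p1-w7` g9; THEOREMS ONLY, `--supports` 20372 `--as helper`; BSD is not proved by any of this)

HONEST FRAMING. Nothing here is a statement about BSD, elliptic curves or Bernoulli numbers; no registered stub is closed. Piece (A1) of the
modular assembly `jmlTwo_six_of_facts : NF-A → NF-Q → (JMLTwo⁶)` (crux notes w7g8-T6 §5b–§5d; w5 g8 HOME/STATUS 2026-08-29T11:06:24Z «what is
left for T6e», item (i)): the Katz vehicle of the 2-adic rung is `V = P·θ` with `P = classProj c (G|U_4)` a form of weight `k + 1/2`; w5 g8's NF-Q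
transport at the flipped cusp (`…FlipRungTwoBracket.exists_isIntegral_bracket_coeff`) consumes (a) a Mathlib `ModularForm (Gamma1 L) (k+1)`
avatar `f` with `f z = P z · θ z`, and (b) the INPUT congruence «every coefficient of `qExpansion 1 f` lies in `p·ℤ̄[1/N]`». This file supplies both
for ANY `P ∈ M_{(2k+1)/2}(L, ψ)` whose `q`-expansion coefficients lie in `p·ℤ̄[1/N]`, and the instance `P = classProj c g` under the CLASS HYPOTHESIS
of (JMLTwo⁶) («`qCoeffs g n ∈ p·ℤ̄[1/N]` for `n ≡ c (mod 8)`»):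

* §1 `exists_modularForm_eq_mul_shimuraTheta` — the avatar with its `q`-expansion `qExpansion 1 f = qExpansion 1 P · Θ`, `Θ ∈ ℕ⟦q⟧`
  (the tree's NF-A socket `exists_modularForm_mul_thetaMul_sq_pow_qExpansion` at `Q = 1`, `p = 1`, and `θ₁ = θ`);
* §2 `exists_vehicle_of_coeff_mem` — avatar + INPUT congruence from «`qCoeffs P n ∈ p·ℤ̄[1/N]` for all `n`» (T4's `forall_coeff_mul`);
* §3 `qCoeffs_classProj_of_mem` (any level: `𝟙_{n ≡ c (8)}·qCoeffs g n`) and **`exists_classVehicle_of_class_hypothesis`** — for `g ∈ M_{K/2}(N_g, χ)`,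
  `P = classProj c g ∈ M_{(2k+1)/2}(L, ψ)` (membership is P2's business and enters as a hypothesis) and the class hypothesis, the avatar `f` of
  `P·θ` on `Γ₁(L)` with every coefficient of `qExpansion 1 f` in `p·ℤ̄[1/N]`.

No definitions, no named facts, no `sorry`. beyond-print theorem: NO (Shimura 1973 §1 bookkeeping). References: [Shimura1973HalfIntegral] §1;
[Katz1973] §1.6 (currency only); crux notes w7g8-T6 §5.
-/

set_option autoImplicit false
-- summit-side namespace `Summit.BirchSwinnertonDyer.BirchSwinnertonDyer.…` (single-conjunct summit, D-0017 layout)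
set_option linter.dupNamespace false

noncomputable section

open UpperHalfPlane hiding I
open Complex CongruenceSubgroup PowerSeries
open scoped MatrixGroups Real ModularForm
open Literature.NumberTheory.EllipticCurves.ModularForms
open Literature.NumberTheory.EllipticCurves.Tunnell1983 (thetaMul classProj hasSum_classProj thetaMul_one_eq_shimuraTheta)

namespace Summit.BirchSwinnertonDyer.BirchSwinnertonDyer.Theorems.PrintCFram.FlipRung

open Summit.BirchSwinnertonDyer.BirchSwinnertonDyer.Theorems.PrintCFram.HalfIntegralBridge

/-! ## §1 The avatar of `P·θ` on `Γ₁(L)` with its `q`-expansion -/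

/-- **THE KATZ VEHICLE AS A `Γ₁`-FORM.** For `P ∈ M_{(2k+1)/2}(L, ψ)` (`4 ∣ L`) there are a Mathlib modular form `f` of weight `k + 1` on `Γ₁(L)`
and `Θ ∈ ℕ⟦q⟧` (the `q`-expansion of `θ`: `Θ = Σ_{m∈ℤ} q^{m²}`, constant term `1`) with `f z = P z · θ z` and
`qExpansion 1 f = qExpansion 1 P · Θ`. [cite: Shimura1973HalfIntegral, §1] -/
theorem exists_modularForm_eq_mul_shimuraTheta {k L : ℕ} [NeZero L] (h4 : 4 ∣ L) {ψ : DirichletCharacter ℂ L} {P : ℍ → ℂ}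
    (hP : P ∈ halfIntModularForms (2 * k + 1) L ψ) :
    ∃ (f : ModularForm (Gamma1 L) ((k + 1 : ℕ) : ℤ)) (Θ : PowerSeries ℕ),
      (∀ z : ℍ, f z = P z * shimuraTheta z) ∧ PowerSeries.coeff 0 Θ = 1 ∧
        qExpansion 1 ⇑f = qExpansion 1 P * Θ.map (Nat.castRingHom ℂ) := by
  obtain ⟨f, Θ, hf, hq, h0, -⟩ :=
    exists_modularForm_mul_thetaMul_sq_pow_qExpansion (Q := 1) one_pos (by simpa using h4) (p := 1) odd_one hP
  refine ⟨f, Θ, fun z ↦ ?_, h0, by simpa using hq⟩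
  have h := congrFun hf z
  simp only [Pi.mul_apply, pow_one, one_pow] at h
  rw [h, thetaMul_one_eq_shimuraTheta]

/-! ## §2 The input congruence: `P ≡ 0 (mod p)` at `∞` gives `P·θ ≡ 0 (mod p)` at `∞` -/

/-- **AVATAR + INPUT SIDE.** If every `q`-expansion coefficient of `P ∈ M_{(2k+1)/2}(L, ψ)` lies in `p·ℤ̄[1/N]` (`∃ y, (∃ j, N^j·y integral) ∧
qCoeffs P n = p·y`), then the avatar `f` of `P·θ` on `Γ₁(L)` has every coefficient of `qExpansion 1 f` in `p·ℤ̄[1/N]` (Cauchy product with the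
natural-number coefficients of `θ`; T4 `forall_coeff_mul`). This is the `hcoef` input of the NF-Q transport at the flipped cusp. [cite: Katz1973, §1.6 Cor. 1.6.2] -/
theorem exists_vehicle_of_coeff_mem {k L : ℕ} [NeZero L] (h4 : 4 ∣ L) {ψ : DirichletCharacter ℂ L} {P : ℍ → ℂ}
    (hP : P ∈ halfIntModularForms (2 * k + 1) L ψ) {N p : ℕ}
    (hcoefP : ∀ n : ℕ, ∃ y : ℂ, (∃ j : ℕ, IsIntegral ℤ ((N : ℂ) ^ j * y)) ∧ qCoeffs P n = (p : ℂ) * y) :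
    ∃ f : ModularForm (Gamma1 L) ((k + 1 : ℕ) : ℤ), (∀ z : ℍ, f z = P z * shimuraTheta z) ∧
      ∀ n : ℕ, ∃ y : ℂ, (∃ j : ℕ, IsIntegral ℤ ((N : ℂ) ^ j * y)) ∧ (qExpansion 1 ⇑f).coeff n = (p : ℂ) * y := by
  obtain ⟨f, Θ, hf, -, hq⟩ := exists_modularForm_eq_mul_shimuraTheta h4 hP
  refine ⟨f, hf, ?_⟩
  rw [hq]
  refine forall_coeff_mul (fun n ↦ ?_) (fun n ↦ ?_)
  · rw [← qCoeffs_apply]; exact hcoefP n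
  · rw [PowerSeries.coeff_map]; exact exists_isIntegral_pow_mul_natCast _

/-! ## §3 The class cut `P = classProj c g` under the class hypothesis of (JMLTwo⁶) -/

/-- `q`-expansion of the class projection at any level: `qCoeffs (P_c g) n = 𝟙_{n ≡ c (8)}·qCoeffs g n` (the Literature's `qCoeffs_classProj` is
stated at level `128`; this is the same computation from `hasSum_classProj`). [folklore] -/
theorem qCoeffs_classProj_of_mem {K N : ℕ} {χ : DirichletCharacter ℂ N} {g : ℍ → ℂ} (hg : g ∈ halfIntModularForms K N χ) (c n : ℕ) :
    qCoeffs (classProj c g) n = if n % 8 = c % 8 then qCoeffs g n else 0 :=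
  congrFun (qCoeffs_eq_of_hasSum (fun τ ↦ hasSum_classProj (hasSum_qCoeffs hg) c τ)) n

/-- **THE VEHICLE OF THE 2-ADIC RUNG UNDER THE CLASS HYPOTHESIS.** Let `g ∈ M_{K/2}(N_g, χ)` (the `U_4`-image of the odd cut of `H_k`,
`…FlipRungTwoOddCutCohen`), `c` a class mod `8`, and suppose `P := classProj c g` lies in `M_{(2k+1)/2}(L, ψ)` (P2, hypothesis `hP`) and the
CLASS HYPOTHESIS of (JMLTwo⁶) holds: `qCoeffs g n ∈ p·ℤ̄[1/N]` for every `n ≡ c (mod 8)`. Then there is `f : ModularForm (Gamma1 L) (k+1)` with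
`f z = P z · θ z` and every coefficient of `qExpansion 1 f` in `p·ℤ̄[1/N]` — the `f`, `hf`, `hcoef` inputs of w5 g8's
`exists_isIntegral_bracket_coeff`. [cite: Katz1973, §1.6 Cor. 1.6.2] [cite: Shimura1973HalfIntegral, §1] -/
theorem exists_classVehicle_of_class_hypothesis {K N_g k L : ℕ} [NeZero L] (h4 : 4 ∣ L) {χ : DirichletCharacter ℂ N_g}
    {ψ : DirichletCharacter ℂ L} {g : ℍ → ℂ} (hg : g ∈ halfIntModularForms K N_g χ) (c : ℕ)
    (hP : classProj c g ∈ halfIntModularForms (2 * k + 1) L ψ) {N p : ℕ}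
    (hclass : ∀ n : ℕ, n % 8 = c % 8 → ∃ y : ℂ, (∃ j : ℕ, IsIntegral ℤ ((N : ℂ) ^ j * y)) ∧ qCoeffs g n = (p : ℂ) * y) :
    ∃ f : ModularForm (Gamma1 L) ((k + 1 : ℕ) : ℤ), (∀ z : ℍ, f z = classProj c g z * shimuraTheta z) ∧
      ∀ n : ℕ, ∃ y : ℂ, (∃ j : ℕ, IsIntegral ℤ ((N : ℂ) ^ j * y)) ∧ (qExpansion 1 ⇑f).coeff n = (p : ℂ) * y := by
  refine exists_vehicle_of_coeff_mem h4 hP (fun n ↦ ?_)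
  rw [qCoeffs_classProj_of_mem hg c n]
  by_cases hn : n % 8 = c % 8
  · rw [if_pos hn]; exact hclass n hn
  · rw [if_neg hn]; exact exists_eq_natCast_mul_zero

end Summit.BirchSwinnertonDyer.BirchSwinnertonDyer.Theorems.PrintCFram.FlipRung

end
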